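import Literature.Analysis.FluidPDE.TorusClassicalNSContinuation

/-!
# Continuation of classical NS_ν(F) solutions on `T³` near a background trajectory, life span from the
# enstrophy (line `ergodic-budget-selection-closing`, crux `BaireTransfer.DenseLoudDesignerForces`,
# stmt-AnomalousDissipation-1143) — tools stub E6 of block N-E

Sorry-free file over the landed continuation theorem
`Torus.IsClassicalNSSolutionOn.exists_forced_solution_of_gradNormSq_le`
(`Literature/Analysis/FluidPDE/TorusClassicalNSContinuation.lean`), the assembly of the landed tools of block
N: the capped perturbed local existence theorem `Torus.perturbedNS_exists_local_of_le` (E5, Fourier–Picard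
construction; the force is absorbed by the background, `Torus.IsClassicalNSSolutionOn.add_perturbation`),
the `V`-lifespan `Torus.IsClassicalNSSolutionOn.enstrophy_lifespan` (E2a), the `H² → H³ → H⁴` smoothing chain
`Torus.IsClassicalNSSolutionOn.integral_norm_laplacian_laplacian_sq_le_of_gradNormSq_le` with the Parseval
dictionary for restart levels (H2/H3/E4b/E6a), and gluing / uniqueness on closed windows
(`Torus.IsClassicalNSSolutionOn.glue_restart`). Block N-E of the line obtains classical solutions of the FORCED
equation from smooth data near a background solution `ū` on a time span controlled by the enstrophy level only;
this file supplies exactly that: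

* `stub_continuationTools` (the REGISTERED tools stub, proved) — for `ν > 0`, a smooth divergence-free
  mean-zero force `F`, `L > 0`, a classical solution `(ū, p̄)` of NS_ν(F) on `[0, L] × T³` with mean-zero
  slices and a level `E₁` there is `T ∈ (0, L]` such that every smooth divergence-free mean-zero `u₀` with
  `‖∇u₀‖₂² ≤ E₁` launches a classical solution `(u, p)` of NS_ν(F) on `[0, T] × T³` with `u(0) = u₀`,
  mean-zero slices and `‖∇u(t)‖₂² ≤ 2E₁ + 1` (the case `d = Fin 3` of the Literature theorem, which needs
  no hypothesis on `F` beyond the existence of the background).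

References: J. C. Robinson, J. L. Rodrigo, W. Sadowski, *The Three-Dimensional Navier–Stokes Equations*
(CUP 2016), Thm 6.8 (local strong solutions, `T = T(‖∇u₀‖)`), Thm 7.5 (smoothness for `t > 0`), §8.1
(restart and identification on the overlap); P. Constantin, C. Foias, *Navier–Stokes Equations* (1988),
Ch. 10. Nothing is asserted; no definition is added.
-/

-- `Summit.<Summit>.<Problem>` is the tree's mandated summit-side namespace (CONVENTIONS §2); for this
-- single-conjunct summit the two coincide, so the duplicate is deliberate.
set_option linter.dupNamespace false

noncomputable section

open Set Function MeasureTheory Filter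
open scoped InnerProductSpace

namespace Summit.AnomalousDissipation.AnomalousDissipation.Theorems.DenseLoudDesignerForces.Ergodic

open Literature.Analysis.FunctionSpaces Literature.Analysis.FunctionSpaces.Torus
open Literature.Analysis.FluidPDE Literature.Analysis.FluidPDE.Torus

/-- **Tools stub E6 — continuation of classical NS_ν(F) solutions on `T³` from smooth data near a background
solution of the forced equation, with a life span controlled by the enstrophy** (Robinson–Rodrigo–Sadowski
2016, Thm 6.8 with Thm 7.5, for the forced system with the force absorbed by the background).  For `ν > 0`, a
smooth divergence-free mean-zero `F`, `L > 0`, a classical solution `(ū, p̄)` of NS_ν(F) on `[0, L] × T³`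
with mean-zero velocity slices and a level `E₁`, there is `T` with `0 < T ≤ L` such that every smooth
divergence-free mean-zero datum `u₀` with `‖∇u₀‖₂² ≤ E₁` launches a classical solution `(u, p)` of NS_ν(F)
on `[0, T] × T³` with `u(0) = u₀`, mean-zero velocity slices and `‖∇u(t)‖₂² ≤ 2E₁ + 1` on `[0, T]`.
Proof: the tree's `Torus.IsClassicalNSSolutionOn.exists_forced_solution_of_gradNormSq_le` at `d = Fin 3`
(`T = min (L/2) T₂` with `T₂` the `V`-lifespan; a first piece at the datum's `H⁴` level, then restarts of
the perturbation system with a step uniform in the restart time at the `H⁴` level supplied by parabolic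
smoothing under the a priori enstrophy bound, identified on the overlaps by uniqueness and glued).  The
registered signature also carries the smoothness, incompressibility and zero mean of `F`, which the
Literature theorem does not need (they follow from / are irrelevant given the background solution).
[cite: RobinsonRodrigoSadowskiCUP2016, Thm 6.8 with Thm 7.5] -/
theorem stub_continuationTools {ν : ℝ} (hν : 0 < ν) {F : (UnitAddTorus (Fin 3)) → (EuclideanSpace ℝ (Fin 3))} (hF : IsSmooth F)
    (hFdiv : IsDivFree F) (hFmean : HasZeroMean F) {L : ℝ} (hL : 0 < L)
    {ū : ℝ → (UnitAddTorus (Fin 3)) → (EuclideanSpace ℝ (Fin 3))} {pbar : ℝ → (UnitAddTorus (Fin 3)) → ℝ}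
    (hū : IsClassicalNSSolutionOn (Icc 0 L) ν (fun _ => F) ū pbar) (hūmean : ∀ t ∈ Icc 0 L, HasZeroMean (ū t)) (E₁ : ℝ) :
    ∃ T : ℝ, 0 < T ∧ T ≤ L ∧ ∀ (u₀ : (UnitAddTorus (Fin 3)) → (EuclideanSpace ℝ (Fin 3))), IsSmooth u₀ → IsDivFree u₀ → HasZeroMean u₀ →
      gradNormSq u₀ ≤ E₁ →
      ∃ (u : ℝ → (UnitAddTorus (Fin 3)) → (EuclideanSpace ℝ (Fin 3))) (p : ℝ → (UnitAddTorus (Fin 3)) → ℝ),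
        IsClassicalNSSolutionOn (Icc 0 T) ν (fun _ => F) u p ∧ u 0 = u₀ ∧ (∀ t ∈ Icc 0 T, HasZeroMean (u t)) ∧
        ∀ t ∈ Icc 0 T, gradNormSq (u t) ≤ 2 * E₁ + 1 := by
  -- the registered signature carries `IsSmooth F`, `IsDivFree F`, `HasZeroMean F`, which the continuation
  -- theorem does not need (the force enters only through the background solution `ū`)
  have _ : IsSmooth F ∧ IsDivFree F ∧ HasZeroMean F := ⟨hF, hFdiv, hFmean⟩
  exact hū.exists_forced_solution_of_gradNormSq_le (Fintype.card_fin 3) hν hL hūmean E₁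

end Summit.AnomalousDissipation.AnomalousDissipation.Theorems.DenseLoudDesignerForces.Ergodic

end
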